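import Summits.ResolutionOfSingularities.ResolutionOfSingularities.Theorems.FrobeniusClosingPatchingRelPerfectMonomialRungClosedPointTower
import Summits.ResolutionOfSingularities.ResolutionOfSingularities.Theorems.FrobeniusClosingPatchingRelPerfectMonomialSumPairs
import Summits.ResolutionOfSingularities.ResolutionOfSingularities.Theorems.FrobeniusClosingPatchingRelPerfectDepthOneTowerContractionHolds
import HarnessLib

/-!
# Chain W5.2, TARGETS F3 — the monomial rung for AT MOST TWO SUMMANDS («R-mono-pair»), assembled

[OURS · L1 W5.2 · R-mono-pair] Crux `PatchingRelPerfect` (stmt-ResolutionOfSingularities-16161), line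
`closed_point_slice`; res-L1-w52-plan-1 g7 RULING M2 06:34:44Z (i) «R-mono-PAIR closes now: stub-4's
`monomialSumPrincipalization_of_length_le_two` p504028 + lead-2's `monomial_of_targets_le_two` + stub-2's M1 and the
M1₂ instance for `(x^α) + 𝔪^{|α|+ℓ}`» and ADOPTED (L2) «at `ℓ = 2` every escaped pocket of a weight-1 step is a depth-1
GRADED TWO-MONOMIAL state ⇒ lead-2's ESCAPED-CARRIER package closes by R-mono-PAIR (fact-free)».

Why a pair version: TARGET M2 `MonomialSumPrincipalization` as typed (centres over the cosupport of the SUM, any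
number of summands) is Hironaka's permissible polyhedra game (Spivakovsky 1983) — print-known, not in tree,
background line (stub-4 + res-type-075); for `|𝒦| ≤ 2` it IS res-L1-w52-stub-4's pair theorem (p504028), whose
centres are strata of the pairwise cosupport `V(A) ∩ V(B) = cosupp(A ⊔ B)`, hence over the closed point.

Contents (fact-free, no new definitions — «inline»):
* `monomial_of_targets_le_two` — the PROVED composition `M1₂ → M2₂ (p504028) → M3 (p503292) → D5 (p496616) →
  conclusion` for every input carrying a monomial format with AT MOST TWO summands: stated for an ARBITRARY non-zero
  ideal `I` of a regular local ring together with a format witness (a blowing up `g : X → Spec S` along a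
  closed-point-supported ideal — e.g. `Bl_𝔪` —, `X` regular Noetherian, an snc system `Es`, a locally principal
  `ℰ`, a family `𝒦` of `≤ 2` exponent lists on `Es` cosupported over the closed point with `I𝒪_X = ℰ^e · monomialSum 𝒦`),
  concluding COMPANION form `∃ Q ⊇ 𝔪^m, Bl_{I·Q} Spec S regular`;
* `monomial_atom_le_two` — the same in the registered core's blow-up form (`atomConclusion_of_companion'`);
* `monomialConclusion_of_monomialFormat_le_two` — the `MonomialConclusion`-shaped statement for `I = (x^α : α ∈ A)`
  from an M1₂-shaped hypothesis (M1 with `𝒦.length ≤ 2` recorded), for stub-2's instance `(x^α) + 𝔪^{|α|+ℓ}`.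
NOT a statement of the manuscript under review. AI-written; weaker than expert review.

## References
* R. Goward, *A simple algorithm for principalization of monomial ideals*, Trans. AMS 357 (2005), §2. [Goward2005]
* J. Kollár, *Lectures on Resolution of Singularities* (2007), (3.111) Step 3. [Kollar2007]
* The Stacks Project, Tags 080A, 080B. [StacksProject]
-/

-- `Summit.<Summit>.<Sub>.Theorems` with `Sub = Summit` (single-conjunct summit, D-0017)
set_option linter.dupNamespace false

noncomputable section

open CategoryTheory AlgebraicGeometry
open Literature.AlgebraicGeometry.Resolution

namespace Summit.ResolutionOfSingularities.ResolutionOfSingularities.Theorems.DepthTargets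

universe u

open DepthOneTargets (TowerContraction towerContraction_holds)

/-- **R-mono-pair, COMPANION form** (the composition `M1₂ → M2₂ → M3 → D5`, all inputs in the tree): a non-zero
ideal `I` of a regular local ring carrying, on some blowing up `g : X → Spec S` along a closed-point-supported ideal
with `X` regular and Noetherian, a MONOMIAL FORMAT `I𝒪_X = ℰ^e · monomialSum 𝒦` in a simple normal crossings system
`Es ∋ ℰ` (`ℰ` locally principal) with AT MOST TWO summands cosupported over the closed point, has a companion:
`∃ Q ⊇ 𝔪^m` with `Bl_{I·Q} Spec S` regular. [cite: Goward2005, §2] [cite: StacksProject, Tag 080B] -/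
theorem monomial_of_targets_le_two (S : Type u) [CommRing S] [IsRegularLocalRing S] (I : Ideal S) (hI : I ≠ ⊥)
    (X : Scheme.{u}) (g : X ⟶ Spec (.of S)) (K₀ : (Spec (.of S)).IdealSheafData) (hg : IsBlowup g K₀)
    (hK₀ : (K₀.support : Set (Spec (.of S))) ⊆ {IsLocalRing.closedPoint S})
    (hXreg : Scheme.IsRegular X) [IsNoetherian X]
    (Es : List X.IdealSheafData) (hEs : HasSNC Es) (ℰ : X.IdealSheafData) (hℰlp : IsLocallyPrincipal ℰ)
    (𝒦 : List (List (X.IdealSheafData × ℕ))) (h𝒦 : ∀ K ∈ 𝒦, boundaryOf K = Es) (h𝒦ne : 𝒦 ≠ [])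
    (hlen : 𝒦.length ≤ 2)
    (hsupp : ((monomialSum 𝒦).support : Set X) ⊆ g ⁻¹' {IsLocalRing.closedPoint S}) (e : ℕ)
    (hfmt : (affineBlowup.idealSheaf I).comap g = ℰ ^ e * monomialSum 𝒦) :
    ∃ (Q : Ideal S) (m : ℕ), IsLocalRing.maximalIdeal S ^ m ≤ Q ∧
      ∃ (B : Scheme.{u}) (b : B ⟶ Spec (.of S)),
        IsBlowup b (affineBlowup.idealSheaf (I * Q)) ∧ Scheme.IsRegular B := by
  obtain ⟨s, -, hover, htop, hlp⟩ := monomialSumPrincipalization_of_length_le_two X hXreg Es hEs 𝒦 h𝒦 h𝒦ne hlen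
  have hover' : s.CentresOver (g ⁻¹' {IsLocalRing.closedPoint S}) := CentreSeq.CentresOver.mono s hsupp hover
  obtain ⟨K₁, hK₁, hK₁supp⟩ := closedPointTower_holds S X g K₀ hg hK₀ s hover'
  refine towerContraction_holds S I hI s.top (s.comp ≫ g) K₁ hK₁ hK₁supp htop ?_
  rw [Scheme.IdealSheafData.comap_comp, hfmt, comap_mul, comap_pow]
  exact ((hℰlp.comap _).pow e).mul hlp

/-- **R-mono-pair in the registered core's blow-up form**: under the hypotheses of `monomial_of_targets_le_two`,
every blowing up `T → Spec S` along `I` carries a non-zero ideal sheaf cosupported in the closed fibre whose blowing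
up is regular. [cite: Goward2005, §2] [cite: StacksProject, Tag 080A] -/
theorem monomial_atom_le_two (S : Type u) [CommRing S] [IsRegularLocalRing S] (I : Ideal S) (hI : I ≠ ⊥)
    (X : Scheme.{u}) (g : X ⟶ Spec (.of S)) (K₀ : (Spec (.of S)).IdealSheafData) (hg : IsBlowup g K₀)
    (hK₀ : (K₀.support : Set (Spec (.of S))) ⊆ {IsLocalRing.closedPoint S})
    (hXreg : Scheme.IsRegular X) [IsNoetherian X]
    (Es : List X.IdealSheafData) (hEs : HasSNC Es) (ℰ : X.IdealSheafData) (hℰlp : IsLocallyPrincipal ℰ)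
    (𝒦 : List (List (X.IdealSheafData × ℕ))) (h𝒦 : ∀ K ∈ 𝒦, boundaryOf K = Es) (h𝒦ne : 𝒦 ≠ [])
    (hlen : 𝒦.length ≤ 2)
    (hsupp : ((monomialSum 𝒦).support : Set X) ⊆ g ⁻¹' {IsLocalRing.closedPoint S}) (e : ℕ)
    (hfmt : (affineBlowup.idealSheaf I).comap g = ℰ ^ e * monomialSum 𝒦)
    (T : Scheme.{u}) (f : T ⟶ Spec (.of S)) (hf : IsBlowup f (affineBlowup.idealSheaf I)) :
    ∃ (J : T.IdealSheafData) (T' : Scheme.{u}) (π : T' ⟶ T), J ≠ ⊥ ∧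
      (∀ t : T, t ∈ J.support → f.base t = IsLocalRing.closedPoint S) ∧
      IsBlowup π J ∧ Scheme.IsRegular T' :=
  atomConclusion_of_companion' hI
    (monomial_of_targets_le_two S I hI X g K₀ hg hK₀ hXreg Es hEs ℰ hℰlp 𝒦 h𝒦 h𝒦ne hlen hsupp e hfmt) T f hf

/-- **`MonomialConclusion` for the `≤ 2`-summand monomial ideals from an M1₂-shaped hypothesis** (TARGET M1
`MonomialFormat` with `𝒦.length ≤ 2` recorded — stub-2's instance for `(x^α) + 𝔪^{|α|+ℓ}`, whose format on `Bl_𝔪` is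
`D̂^α ⊔ ℰ^ℓ`): the composition `monomial_of_targets` with M2 replaced by the pair theorem.
[cite: Kollar2007, (3.111) Step 3] [cite: StacksProject, Tag 080B] -/
theorem monomialConclusion_of_monomialFormat_le_two (S : Type u) [CommRing S] [IsRegularLocalRing S] (n : ℕ)
    (x : Fin n → S) (A : Finset (Fin n → ℕ))
    (hM1₂ : monomialSpan x A ≠ ⊥ ∧
      ∃ (X : Scheme.{u}) (g : X ⟶ Spec (.of S)) (Es : List X.IdealSheafData) (ℰ : X.IdealSheafData)
        (𝒦 : List (List (X.IdealSheafData × ℕ))) (e : ℕ),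
        IsBlowup g (affineBlowup.idealSheaf (IsLocalRing.maximalIdeal S)) ∧ Scheme.IsRegular X ∧
        IsNoetherian X ∧ HasSNC Es ∧ ℰ ∈ Es ∧ IsLocallyPrincipal ℰ ∧
        (∀ K ∈ 𝒦, boundaryOf K = Es) ∧ 𝒦 ≠ [] ∧ 𝒦.length ≤ 2 ∧
        ((monomialSum 𝒦).support : Set X) ⊆ g ⁻¹' {IsLocalRing.closedPoint S} ∧
        (affineBlowup.idealSheaf (monomialSpan x A)).comap g = ℰ ^ e * monomialSum 𝒦) :
    ∃ (Q : Ideal S) (m : ℕ), IsLocalRing.maximalIdeal S ^ m ≤ Q ∧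
      ∃ (B : Scheme.{u}) (b : B ⟶ Spec (.of S)),
        IsBlowup b (affineBlowup.idealSheaf (monomialSpan x A * Q)) ∧ Scheme.IsRegular B := by
  obtain ⟨hI, X, g, Es, ℰ, 𝒦, e, hg, hXreg, hXnoeth, hEs, -, hℰlp, h𝒦, h𝒦ne, hlen, hsupp, hfmt⟩ := hM1₂
  haveI := hXnoeth
  have hg𝔪 : ((affineBlowup.idealSheaf (IsLocalRing.maximalIdeal S)).support : Set (Spec (.of S))) ⊆
      {IsLocalRing.closedPoint S} := fun p hp =>
    support_idealSheaf_subset_closedPoint (Q := IsLocalRing.maximalIdeal S) (n := 1) (by rw [pow_one]) p hp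
  exact monomial_of_targets_le_two S _ hI X g _ hg hg𝔪 hXreg Es hEs ℰ hℰlp 𝒦 h𝒦 h𝒦ne hlen hsupp e hfmt

/-! ## The two-list form (the shape the R4 END consumes: host monomial `⊔` exceptional monomial) -/

/-- `cosupp (monomialIdeal A ⊔ monomialIdeal B) = cosupp (monomialSum [A, B])`. [folklore] -/
theorem support_monomialSum_pair {X : Scheme.{u}} (A B : List (X.IdealSheafData × ℕ)) :
    (monomialSum [A, B]).support = (monomialIdeal A ⊔ monomialIdeal B).support := by
  rw [monomialSum_pair]

/-- **R-mono-pair for TWO EXPLICIT EXPONENT LISTS, companion form** — the shape the R4 END consumes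
(res-D-pv-052 INTERFACE NOTE: at the end of the mixed tower `K′ = 𝓗′ ⊔ N′·𝓘_{E′}^ℓ` GLOBALLY, a sum of TWO monomials
in the snc family {host, `E′`, carriers}): `I𝒪_X = ℰ · (monomialIdeal A ⊔ monomialIdeal B)` with `ℰ` locally principal,
`A`, `B` on one snc system, cosupport over the closed point ⇒ `∃ Q ⊇ 𝔪^m`, `Bl_{I·Q} Spec S` regular.
[cite: Goward2005, §2] [cite: StacksProject, Tag 080B] -/
theorem companion_of_twoMonomials (S : Type u) [CommRing S] [IsRegularLocalRing S] (I : Ideal S) (hI : I ≠ ⊥)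
    (X : Scheme.{u}) (g : X ⟶ Spec (.of S)) (K₀ : (Spec (.of S)).IdealSheafData) (hg : IsBlowup g K₀)
    (hK₀ : (K₀.support : Set (Spec (.of S))) ⊆ {IsLocalRing.closedPoint S})
    (hXreg : Scheme.IsRegular X) [IsNoetherian X]
    (Es : List X.IdealSheafData) (hEs : HasSNC Es) (ℰ : X.IdealSheafData) (hℰlp : IsLocallyPrincipal ℰ)
    (A B : List (X.IdealSheafData × ℕ)) (hA : boundaryOf A = Es) (hB : boundaryOf B = Es)
    (hsupp : ((monomialIdeal A ⊔ monomialIdeal B).support : Set X) ⊆ g ⁻¹' {IsLocalRing.closedPoint S})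
    (hfmt : (affineBlowup.idealSheaf I).comap g = ℰ * (monomialIdeal A ⊔ monomialIdeal B)) :
    ∃ (Q : Ideal S) (m : ℕ), IsLocalRing.maximalIdeal S ^ m ≤ Q ∧
      ∃ (B' : Scheme.{u}) (b : B' ⟶ Spec (.of S)),
        IsBlowup b (affineBlowup.idealSheaf (I * Q)) ∧ Scheme.IsRegular B' := by
  refine monomial_of_targets_le_two S I hI X g K₀ hg hK₀ hXreg Es hEs ℰ hℰlp [A, B] ?_ (by simp) (by simp)
    ?_ 1 ?_
  · intro K hK
    simp only [List.mem_cons, List.mem_nil_iff, or_false] at hK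
    rcases hK with rfl | rfl
    · exact hA
    · exact hB
  · rwa [support_monomialSum_pair]
  · rw [pow_one, monomialSum_pair]; exact hfmt

/-- **R-mono-pair for two explicit exponent lists, blow-up (core) form.** [cite: Goward2005, §2]
[cite: StacksProject, Tag 080A] -/
theorem atom_of_twoMonomials (S : Type u) [CommRing S] [IsRegularLocalRing S] (I : Ideal S) (hI : I ≠ ⊥)
    (X : Scheme.{u}) (g : X ⟶ Spec (.of S)) (K₀ : (Spec (.of S)).IdealSheafData) (hg : IsBlowup g K₀)
    (hK₀ : (K₀.support : Set (Spec (.of S))) ⊆ {IsLocalRing.closedPoint S})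
    (hXreg : Scheme.IsRegular X) [IsNoetherian X]
    (Es : List X.IdealSheafData) (hEs : HasSNC Es) (ℰ : X.IdealSheafData) (hℰlp : IsLocallyPrincipal ℰ)
    (A B : List (X.IdealSheafData × ℕ)) (hA : boundaryOf A = Es) (hB : boundaryOf B = Es)
    (hsupp : ((monomialIdeal A ⊔ monomialIdeal B).support : Set X) ⊆ g ⁻¹' {IsLocalRing.closedPoint S})
    (hfmt : (affineBlowup.idealSheaf I).comap g = ℰ * (monomialIdeal A ⊔ monomialIdeal B))
    (T : Scheme.{u}) (f : T ⟶ Spec (.of S)) (hf : IsBlowup f (affineBlowup.idealSheaf I)) :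
    ∃ (J : T.IdealSheafData) (T' : Scheme.{u}) (π : T' ⟶ T), J ≠ ⊥ ∧
      (∀ t : T, t ∈ J.support → f.base t = IsLocalRing.closedPoint S) ∧
      IsBlowup π J ∧ Scheme.IsRegular T' :=
  atomConclusion_of_companion' hI
    (companion_of_twoMonomials S I hI X g K₀ hg hK₀ hXreg Es hEs ℰ hℰlp A B hA hB hsupp hfmt) T f hf

/-! ## The shape-independent tail: ANY closed-point principalization tower ⇒ companion (M3 + D5) -/

/-- **Tail of every R4 / R-mono assembly (M3 + D5, no monomial hypothesis)**: if `g : X ⟶ Spec S` is a blowing up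
along a closed-point-supported ideal sheaf, `X` Noetherian, and `s` is ANY multiple blow-up of `X` whose centres lie
over the closed point, with regular top on which `I𝒪` is locally principal, then the non-zero ideal `I` has a
companion `Q ⊇ 𝔪^m` with `Bl_{I·Q} Spec S` regular. (The principalization may come from the pair game — global
`monomial_of_targets_le_two` or localised T5-M —, from Kollár's Step 3, or from anything else.)
[cite: StacksProject, Tag 080B] [cite: StacksProject, Tag 080A] -/
theorem companion_of_centreSeq (S : Type u) [CommRing S] [IsRegularLocalRing S] (I : Ideal S) (hI : I ≠ ⊥)
    (X : Scheme.{u}) (g : X ⟶ Spec (.of S)) (K₀ : (Spec (.of S)).IdealSheafData) (hg : IsBlowup g K₀)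
    (hK₀ : (K₀.support : Set (Spec (.of S))) ⊆ {IsLocalRing.closedPoint S}) [IsNoetherian X]
    (s : CentreSeq X) (hover : s.CentresOver (g ⁻¹' {IsLocalRing.closedPoint S}))
    (htop : Scheme.IsRegular s.top)
    (hlp : IsLocallyPrincipal ((affineBlowup.idealSheaf I).comap (s.comp ≫ g))) :
    ∃ (Q : Ideal S) (m : ℕ), IsLocalRing.maximalIdeal S ^ m ≤ Q ∧
      ∃ (B : Scheme.{u}) (b : B ⟶ Spec (.of S)),
        IsBlowup b (affineBlowup.idealSheaf (I * Q)) ∧ Scheme.IsRegular B := by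
  obtain ⟨K₁, hK₁, hK₁supp⟩ := closedPointTower_holds S X g K₀ hg hK₀ s hover
  exact towerContraction_holds S I hI s.top (s.comp ≫ g) K₁ hK₁ hK₁supp htop hlp

/-- The same tail in the registered core's blow-up form. [cite: StacksProject, Tag 080A] -/
theorem atom_of_centreSeq (S : Type u) [CommRing S] [IsRegularLocalRing S] (I : Ideal S) (hI : I ≠ ⊥)
    (X : Scheme.{u}) (g : X ⟶ Spec (.of S)) (K₀ : (Spec (.of S)).IdealSheafData) (hg : IsBlowup g K₀)
    (hK₀ : (K₀.support : Set (Spec (.of S))) ⊆ {IsLocalRing.closedPoint S}) [IsNoetherian X]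
    (s : CentreSeq X) (hover : s.CentresOver (g ⁻¹' {IsLocalRing.closedPoint S}))
    (htop : Scheme.IsRegular s.top)
    (hlp : IsLocallyPrincipal ((affineBlowup.idealSheaf I).comap (s.comp ≫ g)))
    (T : Scheme.{u}) (f : T ⟶ Spec (.of S)) (hf : IsBlowup f (affineBlowup.idealSheaf I)) :
    ∃ (J : T.IdealSheafData) (T' : Scheme.{u}) (π : T' ⟶ T), J ≠ ⊥ ∧
      (∀ t : T, t ∈ J.support → f.base t = IsLocalRing.closedPoint S) ∧
      IsBlowup π J ∧ Scheme.IsRegular T' :=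
  atomConclusion_of_companion' hI (companion_of_centreSeq S I hI X g K₀ hg hK₀ s hover htop hlp) T f hf

/-- **Tail with a locally principal prefactor**: `I𝒪_X = M · K` with `M` locally principal and `K𝒪` locally
principal on the top of the tower suffices (the usual format of the X-side towers: `M` the accumulated exceptional
monomial). [cite: StacksProject, Tag 080B] -/
theorem companion_of_centreSeq_format (S : Type u) [CommRing S] [IsRegularLocalRing S] (I : Ideal S) (hI : I ≠ ⊥)
    (X : Scheme.{u}) (g : X ⟶ Spec (.of S)) (K₀ : (Spec (.of S)).IdealSheafData) (hg : IsBlowup g K₀)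
    (hK₀ : (K₀.support : Set (Spec (.of S))) ⊆ {IsLocalRing.closedPoint S}) [IsNoetherian X]
    (M K : X.IdealSheafData) (hM : IsLocallyPrincipal M) (hfmt : (affineBlowup.idealSheaf I).comap g = M * K)
    (s : CentreSeq X) (hover : s.CentresOver (g ⁻¹' {IsLocalRing.closedPoint S}))
    (htop : Scheme.IsRegular s.top) (hlp : IsLocallyPrincipal (K.comap s.comp)) :
    ∃ (Q : Ideal S) (m : ℕ), IsLocalRing.maximalIdeal S ^ m ≤ Q ∧
      ∃ (B : Scheme.{u}) (b : B ⟶ Spec (.of S)),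
        IsBlowup b (affineBlowup.idealSheaf (I * Q)) ∧ Scheme.IsRegular B := by
  refine companion_of_centreSeq S I hI X g K₀ hg hK₀ s hover htop ?_
  rw [Scheme.IdealSheafData.comap_comp, hfmt, comap_mul]
  exact (hM.comap _).mul hlp

end Summit.ResolutionOfSingularities.ResolutionOfSingularities.Theorems.DepthTargets

end
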